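import Mathlib
import Summits.KontsevichZagierPeriods.Zeta5Search.Certificates.RecordRayPgenDegreeForms
import Summits.KontsevichZagierPeriods.Zeta5Search.Certificates.RecordRayGenericSteps
import HarnessLib

/-! # Record ray, (N) for every `n ≥ 1` — E2. `natDegree (Pgen X i j) ≤ 355` (S4-R1 item #10, step N-2b)

The integer period matrix `Pgen X ∈ M₃(R[X])` of fam-tele's generic record-ray chain (`RecordRayGenericSteps`) has
`natDegree (Pgen X i j) + 2j ≤ 351 + 2i` (graded by the weights `(0,1,2)` of the frame), hence `≤ 355`: every RAISE / DS
step matrix is graded-affine of degree `3`, `H̃` of degree `21`, products add (`135 = 45·3`, `81 = 21 + 20·3`), the adjugate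
doubles (`270`), total `351`.  With 356 integer evaluation points this turns the kernel point identities into the polynomial
identity `Pgen X = c0 • Ĝ(X) • P̂(X)` (`RecordRayIdentify`).  No proposition is DEFINED here: `DZ p a B` (`p = 0 ∨ natDegree p + a ≤ B`) and `GDeg M g` (`∀ i j, DZ (M i j) (2j) (g + 2i)`) are PROSE shorthand (docstrings only); every statement carries the expanded predicate literally.

Provenance: gen-2 g32's kernel-checked scratch `AllN_G15.lean` (2026-08-22, rc 0 / 0 sorry, axioms propext ·
Classical.choice · Quot.sound), built on fam-tele g15's generic record-ray interface (`RecordRayGenericForms/Steps`,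
`RecordRayMirror`, `RecordRayRaySteps`, `RecordRayChain`, all in the tree); data from gen-2 g31 (`P̂`, align) and fam-tele
g14 (`conn/PATH.md`).  Staged for the tree by gen-2 g33 (S4-R1 item #10); gate-lint pass (macros expanded, no metaprogramming) by gen-2 g34.

HONEST FRAMING: systematic search; no irrationality claim unless certified; this is clause (N) of Brown–Zudilin's Theorem 1
(arXiv:2210.03391) for THEIR OWN record cell — the non-vanishing of their linear forms — and nothing about ζ(5) beyond that;
records UNMOVED. -/

namespace Summit.KontsevichZagierPeriods.Zeta5Search.RecordRay.Generic

open Polynomial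

section DegreeTools
variable {R : Type*} [CommRing R]

section Graded
open Matrix

/- `DZ …` is used below only as PROSE shorthand in docstrings; every statement carries the expanded predicate literally (gate lint: no macros). -/

/-- `DZ 0 a B` (the zero polynomial has every graded degree). -/
theorem dz_zero (a B : ℕ) : ((0 : R[X]) = 0 ∨ Polynomial.natDegree (0 : R[X]) + a ≤ B) := Or.inl rfl
/-- A plain degree bound `natDegree p ≤ b` with `b + a ≤ B` gives `DZ p a B`. -/
theorem dz_of_bound {p : R[X]} {b a B : ℕ} (h : p.natDegree ≤ b) (hab : b + a ≤ B) : (p = 0 ∨ Polynomial.natDegree p + a ≤ B) :=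
  Or.inr (by omega)
/-- `DZ` is monotone in the bound. -/
theorem dz_mono {p : R[X]} {a B B' : ℕ} (h : (p = 0 ∨ Polynomial.natDegree p + a ≤ B)) (hB : B ≤ B') : (p = 0 ∨ Polynomial.natDegree p + a ≤ B') := by
  rcases h with h | h
  · exact Or.inl h
  · exact Or.inr (by omega)
/-- `DZ` is closed under addition. -/
theorem dz_add {p q : R[X]} {a B : ℕ} (hp : (p = 0 ∨ Polynomial.natDegree p + a ≤ B)) (hq : (q = 0 ∨ Polynomial.natDegree q + a ≤ B)) : ((p + q) = 0 ∨ Polynomial.natDegree (p + q) + a ≤ B) := by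
  rcases hp with hp | hp
  · rw [hp, zero_add]; exact hq
  rcases hq with hq | hq
  · rw [hq, add_zero]; exact Or.inr hp
  exact Or.inr (by have := natDegree_add_le p q; omega)
/-- `DZ` is closed under negation. -/
theorem dz_neg {p : R[X]} {a B : ℕ} (hp : (p = 0 ∨ Polynomial.natDegree p + a ≤ B)) : ((-p) = 0 ∨ Polynomial.natDegree (-p) + a ≤ B) := by
  rcases hp with hp | hp
  · exact Or.inl (by simp [hp])
  · exact Or.inr (by rwa [natDegree_neg])
/-- `DZ` is closed under subtraction. -/
theorem dz_sub {p q : R[X]} {a B : ℕ} (hp : (p = 0 ∨ Polynomial.natDegree p + a ≤ B)) (hq : (q = 0 ∨ Polynomial.natDegree q + a ≤ B)) : ((p - q) = 0 ∨ Polynomial.natDegree (p - q) + a ≤ B) := by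
  rw [sub_eq_add_neg]; exact dz_add hp (dz_neg hq)
/-- `DZ` of a product: degrees and weights add. -/
theorem dz_mul {p q : R[X]} {a B b C c D : ℕ} (hp : (p = 0 ∨ Polynomial.natDegree p + a ≤ B)) (hq : (q = 0 ∨ Polynomial.natDegree q + b ≤ C)) (h : B + C + c ≤ D + a + b) :
    ((p * q) = 0 ∨ Polynomial.natDegree (p * q) + c ≤ D) := by
  rcases hp with hp | hp
  · exact Or.inl (by simp [hp])
  rcases hq with hq | hq
  · exact Or.inl (by simp [hq])
  exact Or.inr (by have := natDegree_mul_le (p := p) (q := q); omega)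

/- `GDeg …` is used below only as PROSE shorthand in docstrings; every statement carries the expanded predicate literally (gate lint: no macros). -/

/-- Graded degree of an explicit `3 × 3` matrix from its nine entries. -/
theorem gdeg_mk {a00 a01 a02 a10 a11 a12 a20 a21 a22 : R[X]} {g : ℕ}
    (h00 : (a00 = 0 ∨ Polynomial.natDegree a00 + 0 ≤ g)) (h01 : (a01 = 0 ∨ Polynomial.natDegree a01 + 2 ≤ g)) (h02 : (a02 = 0 ∨ Polynomial.natDegree a02 + 4 ≤ g))
    (h10 : (a10 = 0 ∨ Polynomial.natDegree a10 + 0 ≤ (g + 2))) (h11 : (a11 = 0 ∨ Polynomial.natDegree a11 + 2 ≤ (g + 2))) (h12 : (a12 = 0 ∨ Polynomial.natDegree a12 + 4 ≤ (g + 2)))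
    (h20 : (a20 = 0 ∨ Polynomial.natDegree a20 + 0 ≤ (g + 4))) (h21 : (a21 = 0 ∨ Polynomial.natDegree a21 + 2 ≤ (g + 4))) (h22 : (a22 = 0 ∨ Polynomial.natDegree a22 + 4 ≤ (g + 4))) :
    (∀ i j : Fin 3, ((!![a00, a01, a02; a10, a11, a12; a20, a21, a22]) i j = 0 ∨ Polynomial.natDegree ((!![a00, a01, a02; a10, a11, a12; a20, a21, a22]) i j) + 2 * (j : ℕ) ≤ g + 2 * (i : ℕ))) := by
  intro i j; fin_cases i <;> fin_cases j
  exacts [h00, h01, h02, h10, h11, h12, h20, h21, h22]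

section Entries
variable {M : Matrix (Fin 3) (Fin 3) R[X]} {g : ℕ} (h : (∀ i j : Fin 3, (M i j = 0 ∨ Polynomial.natDegree (M i j) + 2 * (j : ℕ) ≤ g + 2 * (i : ℕ))))
include h
/-- Entry `(0,0)` of a graded-degree hypothesis, with the weights evaluated to numerals. -/
theorem gdeg_e00 : ((M 0 0) = 0 ∨ Polynomial.natDegree (M 0 0) + 0 ≤ g) := h 0 0
/-- Entry `(0,1)` of a graded-degree hypothesis, with the weights evaluated to numerals. -/
theorem gdeg_e01 : ((M 0 1) = 0 ∨ Polynomial.natDegree (M 0 1) + 2 ≤ g) := h 0 1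
/-- Entry `(0,2)` of a graded-degree hypothesis, with the weights evaluated to numerals. -/
theorem gdeg_e02 : ((M 0 2) = 0 ∨ Polynomial.natDegree (M 0 2) + 4 ≤ g) := h 0 2
/-- Entry `(1,0)` of a graded-degree hypothesis, with the weights evaluated to numerals. -/
theorem gdeg_e10 : ((M 1 0) = 0 ∨ Polynomial.natDegree (M 1 0) + 0 ≤ (g + 2)) := h 1 0
/-- Entry `(1,1)` of a graded-degree hypothesis, with the weights evaluated to numerals. -/
theorem gdeg_e11 : ((M 1 1) = 0 ∨ Polynomial.natDegree (M 1 1) + 2 ≤ (g + 2)) := h 1 1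
/-- Entry `(1,2)` of a graded-degree hypothesis, with the weights evaluated to numerals. -/
theorem gdeg_e12 : ((M 1 2) = 0 ∨ Polynomial.natDegree (M 1 2) + 4 ≤ (g + 2)) := h 1 2
/-- Entry `(2,0)` of a graded-degree hypothesis, with the weights evaluated to numerals. -/
theorem gdeg_e20 : ((M 2 0) = 0 ∨ Polynomial.natDegree (M 2 0) + 0 ≤ (g + 4)) := h 2 0
/-- Entry `(2,1)` of a graded-degree hypothesis, with the weights evaluated to numerals. -/
theorem gdeg_e21 : ((M 2 1) = 0 ∨ Polynomial.natDegree (M 2 1) + 2 ≤ (g + 4)) := h 2 1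
/-- Entry `(2,2)` of a graded-degree hypothesis, with the weights evaluated to numerals. -/
theorem gdeg_e22 : ((M 2 2) = 0 ∨ Polynomial.natDegree (M 2 2) + 4 ≤ (g + 4)) := h 2 2
end Entries

/-- `GDeg` is monotone in the degree. -/
theorem gdeg_mono {M : Matrix (Fin 3) (Fin 3) R[X]} {g g' : ℕ} (h : (∀ i j : Fin 3, (M i j = 0 ∨ Polynomial.natDegree (M i j) + 2 * (j : ℕ) ≤ g + 2 * (i : ℕ)))) (hg : g ≤ g') : (∀ i j : Fin 3, (M i j = 0 ∨ Polynomial.natDegree (M i j) + 2 * (j : ℕ) ≤ g' + 2 * (i : ℕ))) :=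
  fun i j => dz_mono (h i j) (by omega)

/-- `GDeg` is submultiplicative: `GDeg M g → GDeg N h → GDeg (M * N) (g + h)`. -/
theorem gdeg_mul {M N : Matrix (Fin 3) (Fin 3) R[X]} {g h : ℕ} (hM : (∀ i j : Fin 3, (M i j = 0 ∨ Polynomial.natDegree (M i j) + 2 * (j : ℕ) ≤ g + 2 * (i : ℕ)))) (hN : (∀ i j : Fin 3, (N i j = 0 ∨ Polynomial.natDegree (N i j) + 2 * (j : ℕ) ≤ h + 2 * (i : ℕ)))) :
    (∀ i j : Fin 3, ((M * N) i j = 0 ∨ Polynomial.natDegree ((M * N) i j) + 2 * (j : ℕ) ≤ (g + h) + 2 * (i : ℕ))) := by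
  intro i j
  rw [Matrix.mul_apply, Fin.sum_univ_three]
  exact dz_add (dz_add (dz_mul (hM i 0) (hN 0 j) (by omega)) (dz_mul (hM i 1) (hN 1 j) (by omega)))
    (dz_mul (hM i 2) (hN 2 j) (by omega))

/-- The adjugate doubles the graded degree: `GDeg M g → GDeg M.adjugate (2g)`. -/
theorem gdeg_adjugate {M : Matrix (Fin 3) (Fin 3) R[X]} {g : ℕ} (h : (∀ i j : Fin 3, (M i j = 0 ∨ Polynomial.natDegree (M i j) + 2 * (j : ℕ) ≤ g + 2 * (i : ℕ)))) :
    (∀ i j : Fin 3, (M.adjugate i j = 0 ∨ Polynomial.natDegree (M.adjugate i j) + 2 * (j : ℕ) ≤ (2 * g) + 2 * (i : ℕ))) := by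
  rw [Matrix.adjugate_fin_three]
  refine gdeg_mk ?_ ?_ ?_ ?_ ?_ ?_ ?_ ?_ ?_
  · exact dz_sub (dz_mul (gdeg_e11 h) (gdeg_e22 h) (by omega)) (dz_mul (gdeg_e12 h) (gdeg_e21 h) (by omega))
  · exact dz_add (dz_neg (dz_mul (gdeg_e01 h) (gdeg_e22 h) (by omega))) (dz_mul (gdeg_e02 h) (gdeg_e21 h) (by omega))
  · exact dz_sub (dz_mul (gdeg_e01 h) (gdeg_e12 h) (by omega)) (dz_mul (gdeg_e02 h) (gdeg_e11 h) (by omega))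
  · exact dz_add (dz_neg (dz_mul (gdeg_e10 h) (gdeg_e22 h) (by omega))) (dz_mul (gdeg_e12 h) (gdeg_e20 h) (by omega))
  · exact dz_sub (dz_mul (gdeg_e00 h) (gdeg_e22 h) (by omega)) (dz_mul (gdeg_e02 h) (gdeg_e20 h) (by omega))
  · exact dz_add (dz_neg (dz_mul (gdeg_e00 h) (gdeg_e12 h) (by omega))) (dz_mul (gdeg_e02 h) (gdeg_e10 h) (by omega))
  · exact dz_sub (dz_mul (gdeg_e10 h) (gdeg_e21 h) (by omega)) (dz_mul (gdeg_e11 h) (gdeg_e20 h) (by omega))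
  · exact dz_add (dz_neg (dz_mul (gdeg_e00 h) (gdeg_e21 h) (by omega))) (dz_mul (gdeg_e01 h) (gdeg_e20 h) (by omega))
  · exact dz_sub (dz_mul (gdeg_e00 h) (gdeg_e11 h) (by omega)) (dz_mul (gdeg_e01 h) (gdeg_e10 h) (by omega))

/-- `GDeg 1 0`. -/
theorem gdeg_one : (∀ i j : Fin 3, ((1 : Matrix (Fin 3) (Fin 3) R[X]) i j = 0 ∨ Polynomial.natDegree ((1 : Matrix (Fin 3) (Fin 3) R[X]) i j) + 2 * (j : ℕ) ≤ 0 + 2 * (i : ℕ))) := by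
  rw [Matrix.one_fin_three]
  refine gdeg_mk ?_ ?_ ?_ ?_ ?_ ?_ ?_ ?_ ?_ <;>
    first | exact dz_zero _ _ | exact dz_of_bound nd_one (by decide)

/-- Graded degree of a chain product `M m ⋯ M 1 · M 0`: `d0 + m·d`. -/
theorem gdeg_chainProd (M : ℕ → Matrix (Fin 3) (Fin 3) R[X]) (d0 d : ℕ) (h0 : (∀ i j : Fin 3, ((M 0) i j = 0 ∨ Polynomial.natDegree ((M 0) i j) + 2 * (j : ℕ) ≤ d0 + 2 * (i : ℕ))))
    (h : ∀ k, 1 ≤ k → (∀ i j : Fin 3, ((M k) i j = 0 ∨ Polynomial.natDegree ((M k) i j) + 2 * (j : ℕ) ≤ d + 2 * (i : ℕ)))) : ∀ m, (∀ i j : Fin 3, ((chainProd M (m + 1)) i j = 0 ∨ Polynomial.natDegree ((chainProd M (m + 1)) i j) + 2 * (j : ℕ) ≤ (d0 + m * d) + 2 * (i : ℕ))) := by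
  intro m
  induction m with
  | zero =>
    rw [chainProd_succ, chainProd_zero]
    simpa using gdeg_mul h0 (gdeg_one (R := R))
  | succ m ih =>
    rw [chainProd_succ]
    exact gdeg_mono (gdeg_mul (h (m + 1) (by omega)) ih) (le_of_eq (by ring))

/-! #### E.4 The step matrices are graded-affine -/
section Steps
variable {x : ℕ → R[X]} (hx : (∀ j : ℕ, Polynomial.natDegree (x j) ≤ 1))
include hx

/-- The generic `RAISE₇` step matrix is graded-affine of degree `3`. -/
theorem gdeg_raise7MatG : (∀ i j : Fin 3, ((raise7MatG x) i j = 0 ∨ Polynomial.natDegree ((raise7MatG x) i j) + 2 * (j : ℕ) ≤ 3 + 2 * (i : ℕ))) := by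
  have h0 := natDegree_topGamma0G_le hx
  have h1 := natDegree_topGamma1G_le hx
  have h2 := natDegree_topGamma2G_le hx
  have h3 := natDegree_topGamma3G_le hx
  unfold raise7MatG
  refine gdeg_mk ?_ ?_ ?_ ?_ ?_ ?_ ?_ ?_ ?_ <;>
    first | exact dz_zero _ _ | exact dz_of_bound (by
      apply_rules (maxDepth := 9999) (transparency := .reducible) only [*, nd_add, nd_sub, nd_mul,
        nd_neg, nd_pow, nd_X, nd_one, nd_zero, nd_ofNat, nd_intCast, nd_natCast]) (by decide)

/-- The generic `RAISEᵢ` step matrix is graded-affine of degree `3`. -/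
theorem gdeg_raiseMatG (i : ℕ) : (∀ i' j : Fin 3, ((raiseMatG x i) i' j = 0 ∨ Polynomial.natDegree ((raiseMatG x i) i' j) + 2 * (j : ℕ) ≤ 3 + 2 * (i' : ℕ))) := by
  have h0 := natDegree_topGamma0G_le hx
  have h1 := natDegree_topGamma1G_le hx
  have h2 := natDegree_topGamma2G_le hx
  have h3 := natDegree_topGamma3G_le hx
  have hk0 := natDegree_kapG_le hx i
  have hk1 := natDegree_kapG_le (affPt_bumpG hx 6) i
  have hk2 := natDegree_kapG_le (affPt_bumpG (affPt_bumpG hx 6) 6) i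
  unfold raiseMatG
  refine gdeg_mk ?_ ?_ ?_ ?_ ?_ ?_ ?_ ?_ ?_ <;>
    first | exact dz_zero _ _ | exact dz_of_bound (by
      apply_rules (maxDepth := 9999) (transparency := .reducible) only [*, nd_add, nd_sub, nd_mul,
        nd_neg, nd_pow, nd_X, nd_one, nd_zero, nd_ofNat, nd_intCast, nd_natCast]) (by decide)

/-- The generic lowering step matrix is graded-affine of degree `3`. -/
theorem gdeg_lowerMatG (i : ℕ) : (∀ i' j : Fin 3, ((lowerMatG x i) i' j = 0 ∨ Polynomial.natDegree ((lowerMatG x i) i' j) + 2 * (j : ℕ) ≤ 3 + 2 * (i' : ℕ))) := by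
  unfold lowerMatG
  split_ifs
  · exact gdeg_raise7MatG hx
  · exact gdeg_raiseMatG hx i

/-- The generic diagonal-shift step matrix is graded-affine of degree `3`. -/
theorem gdeg_dsMatG : (∀ i j : Fin 3, ((dsMatG x) i j = 0 ∨ Polynomial.natDegree ((dsMatG x) i j) + 2 * (j : ℕ) ≤ 3 + 2 * (i : ℕ))) := by
  have h0 := natDegree_topGamma0G_le hx
  have h1 := natDegree_topGamma1G_le hx
  have h2 := natDegree_topGamma2G_le hx
  have h3 := natDegree_topGamma3G_le hx
  have hl0 := natDegree_dsLamG_le hx 6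
  have hl1 := natDegree_dsLamG_le (affPt_bumpG hx 6) 6
  have hl2 := natDegree_dsLamG_le (affPt_bumpG (affPt_bumpG hx 6) 6) 6
  unfold dsMatG
  refine gdeg_mk ?_ ?_ ?_ ?_ ?_ ?_ ?_ ?_ ?_ <;>
    first | exact dz_zero _ _ | exact dz_of_bound (by
      apply_rules (maxDepth := 9999) (transparency := .reducible) only [*, nd_add, nd_sub, nd_mul,
        nd_neg, nd_pow, nd_X, nd_one, nd_zero, nd_ofNat, nd_intCast, nd_natCast]) (by decide)

/-- The generic `H̃` matrix is graded of degree `21` (adjugate of a degree-`7` matrix times a degree-`7` matrix). -/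
theorem gdeg_hTildeG : (∀ i j : Fin 3, ((hTildeG x) i j = 0 ∨ Polynomial.natDegree ((hTildeG x) i j) + 2 * (j : ℕ) ≤ 21 + 2 * (i : ℕ))) := by
  have hx1 : (∀ j : ℕ, Polynomial.natDegree ((bumpG x 6) j) ≤ 1) := affPt_bumpG hx 6
  have hx2 : (∀ j : ℕ, Polynomial.natDegree ((bumpG (bumpG x 6) 6) j) ≤ 1) := affPt_bumpG hx1 6
  have a0 := natDegree_topGamma0G_le hx
  have a1 := natDegree_topGamma1G_le hx
  have a2 := natDegree_topGamma2G_le hx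
  have a3 := natDegree_topGamma3G_le hx
  have b0 := natDegree_topGamma0G_le hx1
  have b1 := natDegree_topGamma1G_le hx1
  have b2 := natDegree_topGamma2G_le hx1
  have b3 := natDegree_topGamma3G_le hx1
  have p0 := natDegree_raisePrG_le hx
  have p1 := natDegree_raisePrG_le hx1
  have p2 := natDegree_raisePrG_le hx2
  have t10 := natDegree_raiseTh1G_le hx
  have t20 := natDegree_raiseTh2G_le hx
  have t30 := natDegree_raiseTh3G_le hx
  have t11 := natDegree_raiseTh1G_le hx1
  have t21 := natDegree_raiseTh2G_le hx1
  have t31 := natDegree_raiseTh3G_le hx1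
  have t12 := natDegree_raiseTh1G_le hx2
  have t22 := natDegree_raiseTh2G_le hx2
  have t32 := natDegree_raiseTh3G_le hx2
  unfold hTildeG hScaleG hMatG
  rw [Matrix.adjugate_fin_three_of, Matrix.mul_fin_three]
  refine gdeg_mk ?_ ?_ ?_ ?_ ?_ ?_ ?_ ?_ ?_ <;> exact dz_of_bound (by
    apply_rules (maxDepth := 9999) (transparency := .reducible) only [*, nd_add, nd_sub, nd_mul,
      nd_neg, nd_pow, nd_X, nd_one, nd_zero, nd_ofNat, nd_intCast, nd_natCast]) (by decide)

end Steps

/-! #### E.5 The chain and `Pgen X` -/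

/-- Every A-half step matrix `matA X k` has graded degree `3`. -/
theorem gdeg_matA (k : ℕ) : (∀ i j : Fin 3, ((matA (X : R[X]) k) i j = 0 ∨ Polynomial.natDegree ((matA (X : R[X]) k) i j) + 2 * (j : ℕ) ≤ 3 + 2 * (i : ℕ))) := by
  unfold matA; exact gdeg_lowerMatG (affPt_rayPtG _) _

/-- The first B-half matrix `matB X 0 = H̃` has graded degree `21`. -/
theorem gdeg_matB_zero : (∀ i j : Fin 3, ((matB (X : R[X]) 0) i j = 0 ∨ Polynomial.natDegree ((matB (X : R[X]) 0) i j) + 2 * (j : ℕ) ≤ 21 + 2 * (i : ℕ))) := by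
  unfold matB; rw [if_pos rfl]; exact gdeg_hTildeG (affPt_rayPtG _)

/-- Every later B-half matrix `matB X k`, `k ≥ 1`, has graded degree `3`. -/
theorem gdeg_matB_pos (k : ℕ) (hk : 1 ≤ k) : (∀ i j : Fin 3, ((matB (X : R[X]) k) i j = 0 ∨ Polynomial.natDegree ((matB (X : R[X]) k) i j) + 2 * (j : ℕ) ≤ 3 + 2 * (i : ℕ))) := by
  unfold matB; rw [if_neg (by omega)]; exact gdeg_dsMatG (affPt_rayPtG _)

/-- `GDeg (prodA X) 135` (`45` steps of degree `3`). -/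
theorem gdeg_prodA : (∀ i j : Fin 3, ((prodA (X : R[X])) i j = 0 ∨ Polynomial.natDegree ((prodA (X : R[X])) i j) + 2 * (j : ℕ) ≤ 135 + 2 * (i : ℕ))) :=
  gdeg_chainProd (matA (X : R[X])) 3 3 (gdeg_matA 0) (fun k _ => gdeg_matA k) 44

/-- `GDeg (prodB X) 81` (`21 + 20·3`). -/
theorem gdeg_prodB : (∀ i j : Fin 3, ((prodB (X : R[X])) i j = 0 ∨ Polynomial.natDegree ((prodB (X : R[X])) i j) + 2 * (j : ℕ) ≤ 81 + 2 * (i : ℕ))) :=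
  gdeg_chainProd (matB (X : R[X])) 21 3 gdeg_matB_zero (fun k hk => gdeg_matB_pos k hk) 20

/-- **Graded degree bound of the integer period matrix** (step N-2b): `GDeg (Pgen X) 351`. -/
theorem gdeg_Pgen : (∀ i j : Fin 3, ((Pgen (X : R[X])) i j = 0 ∨ Polynomial.natDegree ((Pgen (X : R[X])) i j) + 2 * (j : ℕ) ≤ 351 + 2 * (i : ℕ))) := by
  unfold Pgen; exact gdeg_mul gdeg_prodB (gdeg_adjugate gdeg_prodA)

/-- `natDegree (Pgen X i j) + 2j ≤ 351 + 2i`, or the entry vanishes. -/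
theorem natDegree_Pgen_graded (i j : Fin 3) :
    Pgen (X : R[X]) i j = 0 ∨ (Pgen (X : R[X]) i j).natDegree + 2 * (j : ℕ) ≤ 351 + 2 * (i : ℕ) :=
  gdeg_Pgen i j

/-- **Uniform degree bound** `natDegree (Pgen X i j) ≤ 355` (so 356 evaluation points identify `Pgen X`). -/
theorem natDegree_Pgen_le (i j : Fin 3) : (Pgen (X : R[X]) i j).natDegree ≤ 355 := by
  have hi := i.isLt
  rcases gdeg_Pgen (R := R) i j with h | h
  · rw [h, natDegree_zero]; omega
  · omega

end Graded

end DegreeTools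

end Summit.KontsevichZagierPeriods.Zeta5Search.RecordRay.Generic
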